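import Literature.NumberTheory.Automorphic.SymplecticSimilitudeBorelModulusIndex
import Literature.NumberTheory.Automorphic.SymplecticSatakeWeylInvariance
import Literature.NumberTheory.Automorphic.SatakeTransformIwasawaFunctoriality
import HarnessLib

/-!
# Transfer from `Sp_{2n}` to `GSp_{2n}`: on the multiplier-zero part of `ℋ(GSp_{2n}(K), GSp_{2n}(𝒪); R)` the Satake
# transform is the push-forward along `ℤⁿ → ℤⁿ × ℤ`, `a ↦ (a, 0)`, of the Satake transform of `Sp_{2n}` — hence invariant
# under the signed permutations `W(C_n)` (Andrianov–Zhuravlev Ch. 3 §3.3 Prop. 3.28, Thm. 3.30; Cartier §IV Thm. 4.1 (b))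

Topic `NumberTheory/Automorphic`; namespace `Literature.NumberTheory.Automorphic.SymplecticCartan` (lane `lit-hodgefound`,
Track 2 foundations; seat `lit-hodgefound-p11`, generation 51, row g51-#1).  DEFINITIONS with bodies (`symplecticCosetToSimilitude`,
`restrictToSymplectic`, `restrictHeckeToSymplectic`) + theorems; no named fact, no instance, no notation.  First step of the
Weyl-group invariance of the Satake transform of `GSp_{2n}` in every rank (A–Z Thm. 3.30 «`Ω(L) = ℚ[x₀, …, xₙ]^W`»): the tree
has the `Sp_{2n}` theorem `coeff_symplecticSatakeTransform_signedPerm` (`SymplecticSatakeWeylInvariance`) and the `w₀`-symmetry of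
`GSp_{2n}` (`coeff_similitudeSatakeTransform_w0`); here the part of `ℋ(GSp)` living on cosets of multiplier valuation `0` is
identified with `ℋ(Sp)` compatibly with the two Satake transforms.

## The mathematics

`G' = GSp(J, K) ⊇ ι(G)`, `G = Sp(J, K)` (`ι = ofSymplectic`), `K₀' = GSp(J, 𝒪)`, `K₀ = Sp(J, 𝒪)`, exponents
`(a, c) : G' → ℤⁿ × ℤ` (`c = ord r`, `similitudeIwasawaExp`) and `a : G → ℤⁿ` (`symplecticIwasawaExp`), with `(a, c) ∘ ι = (a, 0)`
(`similitudeIwasawaExp_ofSymplectic`).  (1) The map **`ῑ : G/K₀ → G'/K₀'`, `A K₀ ↦ ι(A) K₀'`** is well defined, injective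
(`ι(A) ∈ K₀' ↔ A ∈ K₀`) and `G`-equivariant, and its image is exactly the set of cosets `g K₀'` with `v(r(g)) = 1`, i.e. with
multiplier exponent `c = 0` (`g = ι(A) · diag(r(g)·1; 1)` and the unit block lies in `K₀'`; [Kottwitz1992] §7 «`D ≅ 𝔾_m`»).
(2) For a vector `v ∈ R[G'/K₀']` put `v♭ = v ∘ ῑ ∈ R[G/K₀]`; `K₀'`-invariance of `v` gives `K₀`-invariance of `v♭`, and if `v` is
supported on `range ῑ` then `v = ῑ_* v♭`, whence, for every weight `w` on `ℤⁿ × ℤ`,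
**`satakeVec^{G'}_w(v) = (·, 0)_* satakeVec^{G}_{w∘(·,0)}(v♭)`**.  (3) For `T ∈ ℋ_R(G', K₀')` whose vector `T[K₀']` is supported
on multiplier-zero cosets, `T♭ = ofVector((T[K₀'])♭) ∈ ℋ_R(G, K₀)` (Frobenius reciprocity) and, since the weight `q^{⟨ρ, a⟩}` of
`GSp_{2n}` only reads `a`,

  **`𝒮^{GSp}_q(T) = (·, 0)_* 𝒮^{Sp}_q(T♭)`**,  so  `𝒮^{GSp}_q(T)_{(μ, c)} = [c = 0] · 𝒮^{Sp}_q(T♭)_μ`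

and by the `Sp_{2n}` theorem **`𝒮^{GSp}_q(T)_{((ε_i μ_{π i})_i, c)} = 𝒮^{GSp}_q(T)_{(μ, c)}`** for all signed permutations
(`q ∈ Rˣ` the residue cardinality).  (4) Sources: `c` is constant (`= c(g)`) on the support `K₀' g K₀'/K₀'` of `T_g[K₀']` and
ADDITIVE ON PRODUCTS (`(S T)[K₀'] = Σ_γ T[K₀'](γ) π(γ̃) S[K₀']`, Shimura Prop. 3.15), so `T_g T_{g'}` with `c(g) + c(g') = 0` — in
particular `T_g T_{g⁻¹}` — is such a `T`; and for `d ∈ G` commuting with the unit blocks (e.g. diagonal `d`) the orbit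
`K₀' ι(d) K₀'/K₀'` is `ῑ(K₀ d K₀/K₀)` (A–Z Prop. 3.28: «`Φ((M)_{Γ₀}) = α(M) x₀^δ (D)_Λ`» — the coset expansion of a
multiplier-`p^δ` double coset through the Levi), so `(T_{ι d})♭ = T_d` and **`𝒮^{GSp}_q(T_{t(0,a)}) = (·,0)_* 𝒮^{Sp}_q(T_{diag(ϖ^a; ϖ^{-a})})`**.
The sequel (`SymplecticSimilitudeSatakeWeylInvariance`) deduces the invariance of every `𝒮^{GSp}_q(T_g)` under the full Weyl group
of `GSp_{2n}` from (3)–(4) applied to `T_g T_{g⁻¹}`.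

## What is formalised

* §1 **`symplecticCosetToSimilitude l K`** (`ῑ`), `_coe`, **`_injective`**, `_smul` (equivariance),
  **`mem_range_symplecticCosetToSimilitude_iff`** (`↔ v(r(g)) = 1`).
* §2 (`n ≠ 0`) `snd_similitudeIwasawaExp_eq_zero_iff`, `snd_similitudeIwasawaExp_mul` / `_inv` (`c` is a character on all of `G'`),
  **`mem_range_symplecticCosetToSimilitude_iff_snd_eq_zero`**, **`similitudeIwasawaExp_out_symplecticCosetToSimilitude`** (`(a,c)(ῑ η) = (a(η), 0)`).
* §3 **`restrictToSymplectic v`** (`v♭`), `coeff_restrictToSymplectic`, `_add`, `_smul`, **`mapDomain_restrictToSymplectic`**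
  (`ῑ_* v♭ = v`), **`ofMulAction_restrictToSymplectic`** (invariance), **`satakeVec_mapDomain_symplecticCosetToSimilitude`**.
* §4 **`restrictHeckeToSymplectic T`** (`T♭`), `toVector_restrictHeckeToSymplectic`, `similitudeSatakeWeight_comp_inl`,
  **`similitudeSatakeTransform_eq_mapDomain_inl`** (THE TRANSFER), `support_toVector_subset_range_of_snd_eq_zero`,
  `coeff_similitudeSatakeTransform_zero_of_subset` / `_of_subset_of_ne_zero`,
  **`coeff_similitudeSatakeTransform_signedPerm_of_subset`** (signed-permutation invariance on the multiplier-zero part).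
* §5 `snd_similitudeIwasawaExp_out_eq_of_mem_support_doubleCosetOperator`, **`snd_similitudeIwasawaExp_out_eq_of_mem_support_mul`**
  (multiplier exponents add on supports of products), `support_toVector_doubleCosetOperator_mul_subset_range`,
  **`coeff_similitudeSatakeTransform_mul_signedPerm`** (`𝒮_q(T_g T_{g'})`, `c(g) + c(g') = 0`).
* §6 `scalarBlockGSp_mul_ofSymplectic_comm_of_diagonal`, `scalarBlockGSp_one`, **`orbit_coe_ofSymplectic_eq_image`** (the coset
  bijection `K₀' ι(d) K₀'/K₀' = ῑ(K₀ d K₀/K₀)`), `restrictToSymplectic_doubleCosetIndicator`, **`restrictHeckeToSymplectic_doubleCosetOperator`**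
  (`(T_{ι d})♭ = T_d`), **`similitudeSatakeTransform_doubleCosetOperator_ofSymplectic`**,
  **`similitudeSatakeTransform_doubleCosetOperator_similitudeTorusElt_zero`** (`𝒮^{GSp}_q(T_{t(0,a)})` from `Sp`).

## References
* [AndrianovZhuravlev1995] A. N. Andrianov, V. G. Zhuravlev, *Modular Forms and Hecke Operators*, Transl. Math. Monogr. 145
  (1995), Ch. 3 §3 (3.1)–(3.3), Lemma 3.4, Lemma 3.6; §3.3 (3.44)–(3.49), Prop. 3.28, Thm. 3.30.
* [CartierCorvallis1979] P. Cartier, *Representations of 𝔭-adic groups: a survey*, PSPM 33.1 (1979), §I.3–I.4, §IV (4.2), Thm. 4.1 (b).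
* [Satake1963] I. Satake, *Theory of spherical functions on reductive algebraic groups over 𝔭-adic fields*, Publ. Math. IHÉS 18
  (1963), §7.
* [Kottwitz1992] R. E. Kottwitz, *Points on some Shimura varieties over finite fields*, J. AMS 5 (1992), §5 p. 389, §7 p. 393.
* [ShimuraIATAF1971] G. Shimura, *Introduction to the Arithmetic Theory of Automorphic Functions* (1971), §3.1, Prop. 3.15.
* [Tits1979] J. Tits, *Reductive groups over local fields*, PSPM 33.1 (1979), §3.3.3.
-/

noncomputable section

open scoped Valued WithZero MatrixGroups
open Matrix MonoidAlgebra Representation MulAction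

namespace Literature.NumberTheory.Automorphic.SymplecticCartan

open Literature.NumberTheory.Automorphic Literature.NumberTheory.Automorphic.CartanUnique
  Literature.NumberTheory.Automorphic.HermitianLattice

variable {K : Type*} [Field K] {l : Type*} [Fintype l] [DecidableEq l]

/-! ## §1 The coset embedding `ῑ : Sp(J, K)/Sp(J, 𝒪) → GSp(J, K)/GSp(J, 𝒪)` -/

section Coset

variable [Valued K ℤᵐ⁰]

/-- **The coset embedding** `ῑ : Sp(J, K)/Sp(J, 𝒪) → GSp(J, K)/GSp(J, 𝒪)`, `A·Sp(J, 𝒪) ↦ ι(A)·GSp(J, 𝒪)` (well defined since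
`ι(Sp(J, 𝒪)) ⊆ GSp(J, 𝒪)`). [cite: AndrianovZhuravlev1995, Ch. 3 §3 (3.1), Lemma 3.4] [cite: Kottwitz1992, §7 p. 393] -/
def symplecticCosetToSimilitude (l K : Type*) [Field K] [Valued K ℤᵐ⁰] [Fintype l] [DecidableEq l] :
    symplecticGroup l K ⧸ symplecticInt l K → symplecticSimilitudeGroup l K ⧸ symplecticSimilitudeInt l K :=
  Quotient.map' (fun A => ofSymplectic A) fun A B h => by
    rw [QuotientGroup.leftRel_apply] at h ⊢
    rw [← map_inv, ← map_mul]
    exact ofSymplectic_mem_symplecticSimilitudeInt h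

/-- `ῑ(A·Sp(J, 𝒪)) = ι(A)·GSp(J, 𝒪)`. [cite: AndrianovZhuravlev1995, Ch. 3 §3 Lemma 3.4] -/
@[simp] theorem symplecticCosetToSimilitude_coe (A : symplecticGroup l K) :
    symplecticCosetToSimilitude l K (A : symplecticGroup l K ⧸ symplecticInt l K) =
      ((ofSymplectic A : symplecticSimilitudeGroup l K) : symplecticSimilitudeGroup l K ⧸ symplecticSimilitudeInt l K) :=
  rfl

/-- **`ῑ` is injective** (`ι(A)⁻¹ ι(B) = ι(A⁻¹B) ∈ GSp(J, 𝒪)` forces `A⁻¹ B ∈ Sp(J, 𝒪)`). [cite: Kottwitz1992, §7 p. 393] -/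
theorem symplecticCosetToSimilitude_injective : Function.Injective (symplecticCosetToSimilitude l K) := by
  intro x y h
  induction x using QuotientGroup.induction_on with
  | H A =>
    induction y using QuotientGroup.induction_on with
    | H B =>
      rw [symplecticCosetToSimilitude_coe, symplecticCosetToSimilitude_coe, QuotientGroup.eq, ← map_inv, ← map_mul,
        ofSymplectic_mem_symplecticSimilitudeInt_iff] at h
      exact QuotientGroup.eq.2 h

/-- **`ῑ` is `Sp(J, K)`-equivariant**: `ῑ(A • γ) = ι(A) • ῑ(γ)`. [cite: AndrianovZhuravlev1995, Ch. 3 §3 Lemma 3.4] -/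
theorem symplecticCosetToSimilitude_smul (A : symplecticGroup l K) (γ : symplecticGroup l K ⧸ symplecticInt l K) :
    symplecticCosetToSimilitude l K (A • γ) = (ofSymplectic A : symplecticSimilitudeGroup l K) • symplecticCosetToSimilitude l K γ := by
  induction γ using QuotientGroup.induction_on with
  | H B => rw [MulAction.Quotient.smul_coe, smul_eq_mul, symplecticCosetToSimilitude_coe, map_mul, symplecticCosetToSimilitude_coe,
      MulAction.Quotient.smul_coe, smul_eq_mul]

/-- **The image of `ῑ` is the multiplier-zero part**: a coset `g·GSp(J, 𝒪)` is in the range of `ῑ` iff `v(r(g)) = 1`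
(then `g = ι(A) · diag(r(g)·1; 1)` with the unit block in `GSp(J, 𝒪)`). [cite: Kottwitz1992, §7 p. 393] [cite: Tits1979, §3.3.3] -/
theorem mem_range_symplecticCosetToSimilitude_iff [Nonempty l] (g : symplecticSimilitudeGroup l K) :
    (g : symplecticSimilitudeGroup l K ⧸ symplecticSimilitudeInt l K) ∈ Set.range (symplecticCosetToSimilitude l K) ↔
      Valued.v (multiplier g : K) = 1 := by
  constructor
  · rintro ⟨η, hη⟩
    induction η using QuotientGroup.induction_on with
    | H A =>
      rw [symplecticCosetToSimilitude_coe, QuotientGroup.eq] at hη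
      have h := v_multiplier_eq_one_of_mem_symplecticSimilitudeInt hη
      rwa [multiplier_mul, multiplier_inv, multiplier_ofSymplectic, inv_one, one_mul] at h
  · intro hg
    set s : symplecticSimilitudeGroup l K := g * (scalarBlockGSp (multiplier g : K) (multiplier g).ne_zero)⁻¹ with hs
    have hs1 : multiplier s = 1 := by
      rw [hs, multiplier_mul, multiplier_inv]
      refine Units.ext ?_
      rw [Units.val_mul, Units.val_inv_eq_inv_val, multiplier_scalarBlockGSp, Units.val_one, mul_inv_cancel₀ (multiplier g).ne_zero]
    obtain ⟨A, hA⟩ := (mem_range_ofSymplectic_iff s).2 hs1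
    refine ⟨(A : symplecticGroup l K ⧸ symplecticInt l K), ?_⟩
    rw [symplecticCosetToSimilitude_coe, hA, QuotientGroup.eq, hs, _root_.mul_inv_rev, inv_inv, mul_assoc, inv_mul_cancel, mul_one]
    exact scalarBlockGSp_mem_symplecticSimilitudeInt hg

end Coset

/-! ## §2 The multiplier exponent `c` and the image of `ῑ` (`n ≠ 0`) -/

section Exponent

variable [Valued K ℤᵐ⁰] {ϖ : K} {n : ℕ} [NeZero n]

/-- **`c(g) = 0 ↔ v(r(g)) = 1`**: the multiplier exponent of `g ∈ GSp(J, K)` vanishes iff its multiplier is a unit.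
[cite: Kottwitz1992, §7 (Case C)] -/
theorem snd_similitudeIwasawaExp_eq_zero_iff (hϖ : Valued.v ϖ = WithZero.exp (-1 : ℤ)) (g : symplecticSimilitudeGroup (Fin n) K) :
    (similitudeIwasawaExp hϖ g).2 = 0 ↔ Valued.v (multiplier g : K) = 1 := by
  rw [snd_similitudeIwasawaExp, neg_eq_zero]
  constructor
  · intro h
    have hx : Valued.v (multiplier g : K) ≠ 0 := (Valuation.ne_zero_iff _).2 (multiplier g).ne_zero
    rw [← WithZero.exp_log hx, h, WithZero.exp_zero]
  · intro h
    rw [h, WithZero.log_one]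

/-- **`c` is additive on all of `GSp(J, K)`**: `c(g h) = c(g) + c(h)` (the multiplier is a character).
[cite: AndrianovZhuravlev1995, Ch. 1 §4 (4.2)] -/
theorem snd_similitudeIwasawaExp_mul (hϖ : Valued.v ϖ = WithZero.exp (-1 : ℤ)) (g h : symplecticSimilitudeGroup (Fin n) K) :
    (similitudeIwasawaExp hϖ (g * h)).2 = (similitudeIwasawaExp hϖ g).2 + (similitudeIwasawaExp hϖ h).2 := by
  rw [snd_similitudeIwasawaExp, snd_similitudeIwasawaExp, snd_similitudeIwasawaExp, multiplier_mul, Units.val_mul, map_mul,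
    WithZero.log_mul ((Valuation.ne_zero_iff _).2 (multiplier g).ne_zero) ((Valuation.ne_zero_iff _).2 (multiplier h).ne_zero),
    neg_add]

/-- `c(g⁻¹) = -c(g)`. [cite: AndrianovZhuravlev1995, Ch. 3 §3 (3.1)] -/
theorem snd_similitudeIwasawaExp_inv (hϖ : Valued.v ϖ = WithZero.exp (-1 : ℤ)) (g : symplecticSimilitudeGroup (Fin n) K) :
    (similitudeIwasawaExp hϖ g⁻¹).2 = -(similitudeIwasawaExp hϖ g).2 := by
  have h := snd_similitudeIwasawaExp_mul hϖ g g⁻¹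
  rw [mul_inv_cancel, similitudeIwasawaExp_one, Prod.snd_zero] at h
  linarith

/-- **The image of `ῑ` is exactly the multiplier-zero part**: `γ ∈ range ῑ ↔ c(γ̃) = 0`. [cite: Kottwitz1992, §7 (Case C)] -/
theorem mem_range_symplecticCosetToSimilitude_iff_snd_eq_zero (hϖ : Valued.v ϖ = WithZero.exp (-1 : ℤ))
    (γ : symplecticSimilitudeGroup (Fin n) K ⧸ symplecticSimilitudeInt (Fin n) K) :
    γ ∈ Set.range (symplecticCosetToSimilitude (Fin n) K) ↔ (similitudeIwasawaExp hϖ γ.out).2 = 0 := by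
  haveI : Nonempty (Fin n) := ⟨⟨0, Nat.pos_of_ne_zero (NeZero.ne n)⟩⟩
  rw [snd_similitudeIwasawaExp_eq_zero_iff, ← mem_range_symplecticCosetToSimilitude_iff, QuotientGroup.out_eq']

/-- **The exponents along `ῑ`**: `(a, c)(ῑ η) = (a^{Sp}(η), 0)`. [cite: Kottwitz1992, §7 (Case C)] [cite: CartierCorvallis1979, §IV (4.2)] -/
theorem similitudeIwasawaExp_out_symplecticCosetToSimilitude (hϖ : Valued.v ϖ = WithZero.exp (-1 : ℤ))
    (η : symplecticGroup (Fin n) K ⧸ symplecticInt (Fin n) K) :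
    similitudeIwasawaExp hϖ (symplecticCosetToSimilitude (Fin n) K η).out = (symplecticIwasawaExp hϖ η.out, 0) := by
  conv_lhs => rw [← QuotientGroup.out_eq' η, symplecticCosetToSimilitude_coe]
  rw [(isIwasawaExponent_similitude hϖ).apply_out_coe, similitudeIwasawaExp_ofSymplectic]

end Exponent

/-! ## §3 Restriction of vectors to the multiplier-zero part and the transfer of `satakeVec` -/

section Vector

variable [Valued K ℤᵐ⁰] {R : Type*} [CommRing R]

/-- **Restriction of a vector `v ∈ R[GSp/GSp(𝒪)]` to `R[Sp/Sp(𝒪)]`** along `ῑ`: `v♭(η) = v(ῑ η)`.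
[cite: AndrianovZhuravlev1995, Ch. 3 §3.3 (3.44)] -/
def restrictToSymplectic (v : MonoidAlgebra R (symplecticSimilitudeGroup l K ⧸ symplecticSimilitudeInt l K)) :
    MonoidAlgebra R (symplecticGroup l K ⧸ symplecticInt l K) :=
  MonoidAlgebra.comapDomain (symplecticCosetToSimilitude l K) symplecticCosetToSimilitude_injective v

/-- `v♭(η) = v(ῑ η)`. [cite: AndrianovZhuravlev1995, Ch. 3 §3.3 (3.44)] -/
@[simp] theorem coeff_restrictToSymplectic (v : MonoidAlgebra R (symplecticSimilitudeGroup l K ⧸ symplecticSimilitudeInt l K))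
    (η : symplecticGroup l K ⧸ symplecticInt l K) :
    (restrictToSymplectic v).coeff η = v.coeff (symplecticCosetToSimilitude l K η) := by
  rw [restrictToSymplectic, MonoidAlgebra.coeff_comapDomain, Finsupp.comapDomain_apply]

/-- `restrictToSymplectic` is additive (`Φ` «extended by linearity»). [cite: AndrianovZhuravlev1995, Ch. 3 §3.3 (3.44)] -/
theorem restrictToSymplectic_add (v w : MonoidAlgebra R (symplecticSimilitudeGroup l K ⧸ symplecticSimilitudeInt l K)) :
    restrictToSymplectic (v + w) = restrictToSymplectic v + restrictToSymplectic w :=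
  MonoidAlgebra.comapDomain_add _ _ v w

/-- `restrictToSymplectic` commutes with scalars (`Φ` «extended by linearity»). [cite: AndrianovZhuravlev1995, Ch. 3 §3.3 (3.44)] -/
theorem restrictToSymplectic_smul (r : R) (v : MonoidAlgebra R (symplecticSimilitudeGroup l K ⧸ symplecticSimilitudeInt l K)) :
    restrictToSymplectic (r • v) = r • restrictToSymplectic v := by
  refine MonoidAlgebra.ext (Finsupp.ext fun η => ?_)
  rw [coeff_restrictToSymplectic, MonoidAlgebra.coeff_smul, Finsupp.smul_apply, MonoidAlgebra.coeff_smul, Finsupp.smul_apply,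
    coeff_restrictToSymplectic]

/-- **A vector supported on the multiplier-zero part is the push-forward of its restriction**: `ῑ_*(v♭) = v` when
`supp v ⊆ range ῑ`. [cite: AndrianovZhuravlev1995, Ch. 3 §3.3 (3.44)] -/
theorem mapDomain_restrictToSymplectic {v : MonoidAlgebra R (symplecticSimilitudeGroup l K ⧸ symplecticSimilitudeInt l K)}
    (hv : ↑v.coeff.support ⊆ Set.range (symplecticCosetToSimilitude l K)) :
    MonoidAlgebra.mapDomain (symplecticCosetToSimilitude l K) (restrictToSymplectic v) = v :=
  MonoidAlgebra.mapDomain_comapDomain hv _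

/-- **`GSp(J, 𝒪)`-invariance restricts to `Sp(J, 𝒪)`-invariance.** [cite: AndrianovZhuravlev1995, Ch. 3 §3.3 Prop. 3.28] -/
theorem ofMulAction_restrictToSymplectic {v : MonoidAlgebra R (symplecticSimilitudeGroup l K ⧸ symplecticSimilitudeInt l K)}
    (hv : ∀ k ∈ symplecticSimilitudeInt l K,
      ofMulAction R (symplecticSimilitudeGroup l K) (symplecticSimilitudeGroup l K ⧸ symplecticSimilitudeInt l K) k v = v)
    {k : symplecticGroup l K} (hk : k ∈ symplecticInt l K) :
    ofMulAction R (symplecticGroup l K) (symplecticGroup l K ⧸ symplecticInt l K) k (restrictToSymplectic v) =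
      restrictToSymplectic v := by
  refine MonoidAlgebra.ext (Finsupp.ext fun η => ?_)
  rw [Representation.coeff_ofMulAction, coeff_restrictToSymplectic, coeff_restrictToSymplectic, symplecticCosetToSimilitude_smul,
    map_inv, ← Representation.coeff_ofMulAction, hv _ (ofSymplectic_mem_symplecticSimilitudeInt hk)]

variable {ϖ : K} {n : ℕ} [NeZero n]

/-- **TRANSFER OF THE SATAKE TRANSFORM ON VECTORS**: for every `u ∈ R[Sp/Sp(𝒪)]` and every weight `w` on `ℤⁿ × ℤ`,
`satakeVec^{GSp}_w(ῑ_* u) = (·, 0)_* satakeVec^{Sp}_{w ∘ (·,0)}(u)` — the exponents of `ῑ η` are `(a(η), 0)`.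
[cite: CartierCorvallis1979, §IV (4.2)] [cite: AndrianovZhuravlev1995, Ch. 3 §3.3 (3.44)–(3.49)] -/
theorem satakeVec_mapDomain_symplecticCosetToSimilitude (hϖ : Valued.v ϖ = WithZero.exp (-1 : ℤ))
    (w : Multiplicative ((Fin n → ℤ) × ℤ) →* R) (u : MonoidAlgebra R (symplecticGroup (Fin n) K ⧸ symplecticInt (Fin n) K)) :
    IsIwasawaExponent.satakeVec (symplecticSimilitudeInt (Fin n) K) (similitudeIwasawaExp hϖ) w
        (MonoidAlgebra.mapDomain (symplecticCosetToSimilitude (Fin n) K) u) =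
      AddMonoidAlgebra.mapDomain (AddMonoidHom.inl (Fin n → ℤ) ℤ)
        (IsIwasawaExponent.satakeVec (symplecticInt (Fin n) K) (symplecticIwasawaExp hϖ)
          (w.comp (AddMonoidHom.toMultiplicative (AddMonoidHom.inl (Fin n → ℤ) ℤ))) u) := by
  induction u using MonoidAlgebra.induction_linear with
  | zero => simp only [map_zero, MonoidAlgebra.mapDomain_zero, AddMonoidAlgebra.mapDomain_zero]
  | add x y hx hy => rw [MonoidAlgebra.mapDomain_add, map_add, map_add, AddMonoidAlgebra.mapDomain_add, hx, hy]
  | single η r =>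
    rw [MonoidAlgebra.mapDomain_single, IsIwasawaExponent.satakeVec_single, IsIwasawaExponent.satakeVec_single,
      AddMonoidAlgebra.mapDomain_single, similitudeIwasawaExp_out_symplecticCosetToSimilitude hϖ]
    rfl

end Vector

/-! ## §4 The multiplier-zero part of `ℋ(GSp)`: restriction to `ℋ(Sp)` and the transfer of the Satake transform -/

section Hecke

variable [Valued K ℤᵐ⁰] {ϖ : K} {n : ℕ} {R : Type*} [CommRing R]

/-- **Restriction of a multiplier-zero Hecke operator to `Sp`**: for `T ∈ ℋ_R(GSp(J, K), GSp(J, 𝒪))` the operator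
`T♭ ∈ ℋ_R(Sp(J, K), Sp(J, 𝒪))` with `T♭[Sp(J, 𝒪)] = (T[GSp(J, 𝒪)])♭` (Frobenius reciprocity: a `Sp(J, 𝒪)`-invariant vector
IS a Hecke operator, `heckeAlgebra.ofVector`). [cite: AndrianovZhuravlev1995, Ch. 3 §3.3 Prop. 3.28] [cite: CartierCorvallis1979, §I.3–I.4] -/
def restrictHeckeToSymplectic (T : heckeAlgebra R (symplecticSimilitudeGroup (Fin n) K) (symplecticSimilitudeInt (Fin n) K)) :
    heckeAlgebra R (symplecticGroup (Fin n) K) (symplecticInt (Fin n) K) :=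
  heckeAlgebra.ofVector (symplecticInt (Fin n) K)
    (restrictToSymplectic (heckeAlgebra.toVector (symplecticSimilitudeInt (Fin n) K) T))
    fun _ hk => ofMulAction_restrictToSymplectic (fun _ hk' => heckeAlgebra.ofMulAction_toVector _ T hk') hk

/-- `T♭[Sp(J, 𝒪)] = (T[GSp(J, 𝒪)])♭`. [cite: CartierCorvallis1979, §I.3–I.4] -/
@[simp] theorem toVector_restrictHeckeToSymplectic
    (T : heckeAlgebra R (symplecticSimilitudeGroup (Fin n) K) (symplecticSimilitudeInt (Fin n) K)) :
    heckeAlgebra.toVector (symplecticInt (Fin n) K) (restrictHeckeToSymplectic T) =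
      restrictToSymplectic (heckeAlgebra.toVector (symplecticSimilitudeInt (Fin n) K) T) :=
  heckeAlgebra.toVector_ofVector _ _ _

/-- The weight of `GSp_{2n}` restricted along `(·, 0)` is the weight of `Sp_{2n}`: `q^{⟨ρ, fst(a, 0)⟩} = q^{⟨ρ, a⟩}`.
[cite: CartierCorvallis1979, §IV (4.2)] -/
theorem similitudeSatakeWeight_comp_inl (q : Rˣ) :
    (similitudeSatakeWeight (n := n) q).comp (AddMonoidHom.toMultiplicative (AddMonoidHom.inl (Fin n → ℤ) ℤ)) =
      symplecticSatakeWeight q := by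
  refine MonoidHom.ext fun a => ?_
  rw [MonoidHom.comp_apply, AddMonoidHom.toMultiplicative_apply_apply, AddMonoidHom.inl_apply,
    show Multiplicative.ofAdd (Multiplicative.toAdd a, (0 : ℤ)) = Multiplicative.ofAdd (Multiplicative.toAdd a, (0 : ℤ)) from rfl,
    similitudeSatakeWeight_ofAdd, ← symplecticSatakeWeight_ofAdd, ofAdd_toAdd]

variable [NeZero n]

/-- **TRANSFER OF THE SATAKE TRANSFORM** (`GSp_{2n}` from `Sp_{2n}` on the multiplier-zero part): if `T[GSp(J, 𝒪)]` is supported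
on the image of `ῑ` (every coset in its support has multiplier exponent `0`), then
`𝒮^{GSp}_q(T) = (·, 0)_* 𝒮^{Sp}_q(T♭)`. [cite: CartierCorvallis1979, §IV (4.2)] [cite: AndrianovZhuravlev1995, Ch. 3 §3.3 (3.49), Prop. 3.28] -/
theorem similitudeSatakeTransform_eq_mapDomain_inl (hϖ : Valued.v ϖ = WithZero.exp (-1 : ℤ)) (q : Rˣ)
    {T : heckeAlgebra R (symplecticSimilitudeGroup (Fin n) K) (symplecticSimilitudeInt (Fin n) K)}
    (hT : ↑(heckeAlgebra.toVector (symplecticSimilitudeInt (Fin n) K) T).coeff.support ⊆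
      Set.range (symplecticCosetToSimilitude (Fin n) K)) :
    similitudeSatakeTransform hϖ q T =
      AddMonoidAlgebra.mapDomain (AddMonoidHom.inl (Fin n → ℤ) ℤ) (symplecticSatakeTransform hϖ q (restrictHeckeToSymplectic T)) := by
  rw [similitudeSatakeTransform_apply, symplecticSatakeTransform_apply, toVector_restrictHeckeToSymplectic,
    ← similitudeSatakeWeight_comp_inl q, ← satakeVec_mapDomain_symplecticCosetToSimilitude hϖ, mapDomain_restrictToSymplectic hT]

/-- The support hypothesis from the multiplier exponent: `c(γ̃) = 0` on the support of `T[GSp(J, 𝒪)]` puts it inside `range ῑ`.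
[cite: Kottwitz1992, §7 (Case C)] -/
theorem support_toVector_subset_range_of_snd_eq_zero (hϖ : Valued.v ϖ = WithZero.exp (-1 : ℤ))
    {T : heckeAlgebra R (symplecticSimilitudeGroup (Fin n) K) (symplecticSimilitudeInt (Fin n) K)}
    (hT : ∀ γ ∈ (heckeAlgebra.toVector (symplecticSimilitudeInt (Fin n) K) T).coeff.support, (similitudeIwasawaExp hϖ γ.out).2 = 0) :
    ↑(heckeAlgebra.toVector (symplecticSimilitudeInt (Fin n) K) T).coeff.support ⊆
      Set.range (symplecticCosetToSimilitude (Fin n) K) := fun γ hγ =>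
  (mem_range_symplecticCosetToSimilitude_iff_snd_eq_zero hϖ γ).2 (hT γ hγ)

/-- **Coefficients of the transferred transform**: at `(μ, 0)` the coefficient of `𝒮^{GSp}_q(T)` is that of `𝒮^{Sp}_q(T♭)` at `μ`.
[cite: CartierCorvallis1979, §IV (4.2)] -/
theorem coeff_similitudeSatakeTransform_zero_of_subset (hϖ : Valued.v ϖ = WithZero.exp (-1 : ℤ)) (q : Rˣ)
    {T : heckeAlgebra R (symplecticSimilitudeGroup (Fin n) K) (symplecticSimilitudeInt (Fin n) K)}
    (hT : ↑(heckeAlgebra.toVector (symplecticSimilitudeInt (Fin n) K) T).coeff.support ⊆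
      Set.range (symplecticCosetToSimilitude (Fin n) K)) (μ : Fin n → ℤ) :
    (similitudeSatakeTransform hϖ q T).coeff (μ, 0) = (symplecticSatakeTransform hϖ q (restrictHeckeToSymplectic T)).coeff μ := by
  rw [similitudeSatakeTransform_eq_mapDomain_inl hϖ q hT, AddMonoidAlgebra.mapDomain, AddMonoidAlgebra.coeff_ofCoeff,
    show ((μ, (0 : ℤ)) : (Fin n → ℤ) × ℤ) = AddMonoidHom.inl (Fin n → ℤ) ℤ μ from rfl,
    Finsupp.mapDomain_apply (fun a b h => (Prod.ext_iff.1 h).1)]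

/-- … and it vanishes at `(μ, c)` for `c ≠ 0`. [cite: CartierCorvallis1979, §IV (4.2)] -/
theorem coeff_similitudeSatakeTransform_of_subset_of_ne_zero (hϖ : Valued.v ϖ = WithZero.exp (-1 : ℤ)) (q : Rˣ)
    {T : heckeAlgebra R (symplecticSimilitudeGroup (Fin n) K) (symplecticSimilitudeInt (Fin n) K)}
    (hT : ↑(heckeAlgebra.toVector (symplecticSimilitudeInt (Fin n) K) T).coeff.support ⊆
      Set.range (symplecticCosetToSimilitude (Fin n) K)) (μ : Fin n → ℤ) {c : ℤ} (hc : c ≠ 0) :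
    (similitudeSatakeTransform hϖ q T).coeff (μ, c) = 0 := by
  rw [similitudeSatakeTransform_eq_mapDomain_inl hϖ q hT, AddMonoidAlgebra.mapDomain, AddMonoidAlgebra.coeff_ofCoeff]
  refine Finsupp.mapDomain_notin_range _ _ ?_
  rintro ⟨a, ha⟩
  exact hc ((Prod.ext_iff.1 ha).2.symm)

variable [CompactSpace 𝒪[K]] [Finite 𝓀[K]]

/-- **SIGNED-PERMUTATION INVARIANCE ON THE MULTIPLIER-ZERO PART OF `ℋ(GSp_{2n})`** (Cartier Thm. 4.1 (b) for `Sp_{2n}`,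
transferred): if `T[GSp(J, 𝒪)]` is supported on multiplier-zero cosets, then for every sign vector `ε`, permutation `π`,
`μ ∈ ℤⁿ` and `c ∈ ℤ`, `𝒮_q(T)_{((ε_i μ_{π i})_i, c)} = 𝒮_q(T)_{(μ, c)}` (both vanish unless `c = 0`; at `c = 0` this is the
`W(C_n)`-invariance of `𝒮^{Sp}_q(T♭)`, `coeff_symplecticSatakeTransform_signedPerm`).
[cite: CartierCorvallis1979, §IV Thm. 4.1 (b)] [cite: Satake1963, §7] [cite: AndrianovZhuravlev1995, Ch. 3 §3.3 Thm. 3.30] -/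
theorem coeff_similitudeSatakeTransform_signedPerm_of_subset (hϖ : Valued.v ϖ = WithZero.exp (-1 : ℤ)) (q : Rˣ)
    (hq : (q : R) = Nat.card 𝓀[K])
    {T : heckeAlgebra R (symplecticSimilitudeGroup (Fin n) K) (symplecticSimilitudeInt (Fin n) K)}
    (hT : ↑(heckeAlgebra.toVector (symplecticSimilitudeInt (Fin n) K) T).coeff.support ⊆
      Set.range (symplecticCosetToSimilitude (Fin n) K))
    (ε : Fin n → ℤˣ) (π : Equiv.Perm (Fin n)) (μ : Fin n → ℤ) (c : ℤ) :
    (similitudeSatakeTransform hϖ q T).coeff (fun i => (ε i : ℤ) * μ (π i), c) = (similitudeSatakeTransform hϖ q T).coeff (μ, c) := by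
  by_cases hc : c = 0
  · subst hc
    rw [coeff_similitudeSatakeTransform_zero_of_subset hϖ q hT, coeff_similitudeSatakeTransform_zero_of_subset hϖ q hT,
      coeff_symplecticSatakeTransform_signedPerm hϖ q hq]
  · rw [coeff_similitudeSatakeTransform_of_subset_of_ne_zero hϖ q hT _ hc,
      coeff_similitudeSatakeTransform_of_subset_of_ne_zero hϖ q hT _ hc]

end Hecke

/-! ## §5 Multiplier exponents of supports: double cosets and products -/

section Support

variable [Valued K ℤᵐ⁰] {ϖ : K} {n : ℕ} [NeZero n] {R : Type*} [CommRing R]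

/-- **The support of `T_g[K₀]` has multiplier exponent `c(g)`** (it is the double coset `K₀ g K₀`, on which `c` is constant).
[cite: AndrianovZhuravlev1995, Ch. 3 §3 (3.3)] -/
theorem snd_similitudeIwasawaExp_out_eq_of_mem_support_doubleCosetOperator (hϖ : Valued.v ϖ = WithZero.exp (-1 : ℤ))
    [IsHeckeTriple (⊤ : Submonoid (symplecticSimilitudeGroup (Fin n) K)) (symplecticSimilitudeInt (Fin n) K)
      (symplecticSimilitudeInt (Fin n) K)]
    (g : symplecticSimilitudeGroup (Fin n) K) {γ : symplecticSimilitudeGroup (Fin n) K ⧸ symplecticSimilitudeInt (Fin n) K}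
    (hγ : γ ∈ (heckeAlgebra.toVector (symplecticSimilitudeInt (Fin n) K)
      (heckeAlgebra.doubleCosetOperator (k := R) (symplecticSimilitudeInt (Fin n) K) g)).coeff.support) :
    (similitudeIwasawaExp hϖ γ.out).2 = (similitudeIwasawaExp hϖ g).2 := by
  classical
  refine snd_similitudeIwasawaExp_eq_of_mem_orbit_coe hϖ g ?_
  rw [Finsupp.mem_support_iff, heckeAlgebra.toVector_doubleCosetOperator, heckeAlgebra.coeff_doubleCosetIndicator] at hγ
  by_contra h
  exact hγ (if_neg h)

/-- **Multiplier exponents add on supports of products**: if `S[K₀]` is supported on cosets of multiplier exponent `c₁` and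
`T[K₀]` on cosets of exponent `c₂`, then `(S T)[K₀]` is supported on cosets of exponent `c₁ + c₂`
(`(S T)[K₀] = Σ_γ T[K₀](γ) π(γ̃) S[K₀]`). [cite: ShimuraIATAF1971, Prop. 3.15] [cite: AndrianovZhuravlev1995, Ch. 3 §3 (3.3)] -/
theorem snd_similitudeIwasawaExp_out_eq_of_mem_support_mul (hϖ : Valued.v ϖ = WithZero.exp (-1 : ℤ))
    {S T : heckeAlgebra R (symplecticSimilitudeGroup (Fin n) K) (symplecticSimilitudeInt (Fin n) K)} {c₁ c₂ : ℤ}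
    (hS : ∀ γ ∈ (heckeAlgebra.toVector (symplecticSimilitudeInt (Fin n) K) S).coeff.support, (similitudeIwasawaExp hϖ γ.out).2 = c₁)
    (hT : ∀ γ ∈ (heckeAlgebra.toVector (symplecticSimilitudeInt (Fin n) K) T).coeff.support, (similitudeIwasawaExp hϖ γ.out).2 = c₂)
    {δ : symplecticSimilitudeGroup (Fin n) K ⧸ symplecticSimilitudeInt (Fin n) K}
    (hδ : δ ∈ (heckeAlgebra.toVector (symplecticSimilitudeInt (Fin n) K) (S * T)).coeff.support) :
    (similitudeIwasawaExp hϖ δ.out).2 = c₁ + c₂ := by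
  classical
  rw [Finsupp.mem_support_iff, heckeAlgebra.toVector_mul_eq_sum, MonoidAlgebra.coeff_sum, Finset.sum_apply'] at hδ
  obtain ⟨γ, hγ, hγδ⟩ := Finset.exists_ne_zero_of_sum_ne_zero hδ
  rw [MonoidAlgebra.coeff_smul, Finsupp.smul_apply, smul_eq_mul, Representation.coeff_ofMulAction] at hγδ
  have h2 : (heckeAlgebra.toVector (symplecticSimilitudeInt (Fin n) K) S).coeff (γ.out⁻¹ • δ) ≠ 0 := fun h => hγδ (by rw [h, mul_zero])
  have hS' := hS _ (Finsupp.mem_support_iff.2 h2)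
  have hT' := hT γ hγ
  -- `(γ̃⁻¹ • δ)~ ≡ γ̃⁻¹ δ̃ (mod K₀)`, and `c` is right `K₀`-invariant and additive
  have hout : (similitudeIwasawaExp hϖ (γ.out⁻¹ • δ).out).2 = (similitudeIwasawaExp hϖ (γ.out⁻¹ * δ.out)).2 := by
    conv_lhs => rw [← QuotientGroup.out_eq' δ, MulAction.Quotient.smul_coe, smul_eq_mul]
    rw [(isIwasawaExponent_similitude hϖ).apply_out_coe]
  rw [hout, snd_similitudeIwasawaExp_mul, snd_similitudeIwasawaExp_inv, hT'] at hS'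
  linarith

/-- **`T_g T_{g'}` with `c(g) + c(g') = 0` is supported on the multiplier-zero part** (e.g. `T_g T_{g⁻¹}`).
[cite: ShimuraIATAF1971, Prop. 3.15] [cite: AndrianovZhuravlev1995, Ch. 3 §3 (3.3)] -/
theorem support_toVector_doubleCosetOperator_mul_subset_range (hϖ : Valued.v ϖ = WithZero.exp (-1 : ℤ))
    [IsHeckeTriple (⊤ : Submonoid (symplecticSimilitudeGroup (Fin n) K)) (symplecticSimilitudeInt (Fin n) K)
      (symplecticSimilitudeInt (Fin n) K)]
    {g g' : symplecticSimilitudeGroup (Fin n) K} (hgg' : (similitudeIwasawaExp hϖ g).2 + (similitudeIwasawaExp hϖ g').2 = 0) :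
    ↑(heckeAlgebra.toVector (symplecticSimilitudeInt (Fin n) K)
        (heckeAlgebra.doubleCosetOperator (k := R) (symplecticSimilitudeInt (Fin n) K) g *
          heckeAlgebra.doubleCosetOperator (k := R) (symplecticSimilitudeInt (Fin n) K) g')).coeff.support ⊆
      Set.range (symplecticCosetToSimilitude (Fin n) K) :=
  support_toVector_subset_range_of_snd_eq_zero hϖ fun δ hδ => by
    rw [snd_similitudeIwasawaExp_out_eq_of_mem_support_mul hϖ
      (fun γ hγ => snd_similitudeIwasawaExp_out_eq_of_mem_support_doubleCosetOperator hϖ g hγ)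
      (fun γ hγ => snd_similitudeIwasawaExp_out_eq_of_mem_support_doubleCosetOperator hϖ g' hγ) hδ, hgg']

/-- **`𝒮_q(T_g T_{g'})` is invariant under signed permutations of the `ℤⁿ`-exponent whenever `c(g) + c(g') = 0`.**
[cite: CartierCorvallis1979, §IV Thm. 4.1 (b)] [cite: AndrianovZhuravlev1995, Ch. 3 §3.3 Thm. 3.30] -/
theorem coeff_similitudeSatakeTransform_mul_signedPerm [CompactSpace 𝒪[K]] [Finite 𝓀[K]]
    [IsHeckeTriple (⊤ : Submonoid (symplecticSimilitudeGroup (Fin n) K)) (symplecticSimilitudeInt (Fin n) K)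
      (symplecticSimilitudeInt (Fin n) K)]
    (hϖ : Valued.v ϖ = WithZero.exp (-1 : ℤ)) (q : Rˣ) (hq : (q : R) = Nat.card 𝓀[K])
    {g g' : symplecticSimilitudeGroup (Fin n) K} (hgg' : (similitudeIwasawaExp hϖ g).2 + (similitudeIwasawaExp hϖ g').2 = 0)
    (ε : Fin n → ℤˣ) (π : Equiv.Perm (Fin n)) (μ : Fin n → ℤ) (c : ℤ) :
    (similitudeSatakeTransform hϖ q (heckeAlgebra.doubleCosetOperator (symplecticSimilitudeInt (Fin n) K) g *
        heckeAlgebra.doubleCosetOperator (symplecticSimilitudeInt (Fin n) K) g')).coeff (fun i => (ε i : ℤ) * μ (π i), c) =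
      (similitudeSatakeTransform hϖ q (heckeAlgebra.doubleCosetOperator (symplecticSimilitudeInt (Fin n) K) g *
        heckeAlgebra.doubleCosetOperator (symplecticSimilitudeInt (Fin n) K) g')).coeff (μ, c) :=
  coeff_similitudeSatakeTransform_signedPerm_of_subset hϖ q hq (support_toVector_doubleCosetOperator_mul_subset_range hϖ hgg') ε π μ c

end Support

/-! ## §6 Double cosets of `Sp`-elements commuting with the unit blocks: `𝒮^{GSp}_q(T_{ι d}) = (·, 0)_* 𝒮^{Sp}_q(T_d)` -/

section Diagonal

/-- Diagonal symplectic matrices commute with the unit blocks `diag(u·1; 1)`. [cite: Kottwitz1992, §7 p. 393] -/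
theorem scalarBlockGSp_mul_ofSymplectic_comm_of_diagonal {d : symplecticGroup l K} {f : l ⊕ l → K}
    (hd : (d : Matrix (l ⊕ l) (l ⊕ l) K) = Matrix.diagonal f) (u : K) (hu : u ≠ 0) :
    scalarBlockGSp u hu * ofSymplectic d = ofSymplectic d * scalarBlockGSp u hu := by
  refine Subtype.ext (Units.ext ?_)
  rw [Subgroup.coe_mul, Subgroup.coe_mul, Units.val_mul, Units.val_mul, coe_coe_scalarBlockGSp, coe_ofSymplectic, hd,
    Matrix.diagonal_mul_diagonal, Matrix.diagonal_mul_diagonal]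
  congr 1
  funext s
  exact mul_comm _ _

/-- `diag(1·1; 1) = 1`. [cite: Kottwitz1992, §7 p. 393] -/
theorem scalarBlockGSp_one : (scalarBlockGSp (1 : K) one_ne_zero : symplecticSimilitudeGroup l K) = 1 := by
  refine Subtype.ext (Units.ext ?_)
  rw [coe_coe_scalarBlockGSp, OneMemClass.coe_one, Units.val_one, ← Matrix.diagonal_one]
  congr 1
  funext s
  rcases s with i | i <;> rfl

variable [Valued K ℤᵐ⁰] {ϖ : K} {n : ℕ} {R : Type*} [CommRing R]

/-- **The `GSp(J, 𝒪)`-orbit of `ι(d)` is the image of the `Sp(J, 𝒪)`-orbit of `d`** when `d ∈ Sp(J, K)` commutes with the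
unit blocks `diag(u·1; 1)` (write `k' = ι(S)·diag(u·1; 1)` with `S ∈ Sp(J, 𝒪)`: `k' ι(d) K₀' = ι(S d) K₀'`) — the coset
bijection `GSp(𝒪) ι(d) GSp(𝒪)/GSp(𝒪) ↔ Sp(𝒪) d Sp(𝒪)/Sp(𝒪)`. [cite: AndrianovZhuravlev1995, Ch. 3 §3 Lemma 3.6, §3.3 Prop. 3.28]
[cite: Kottwitz1992, §7 p. 393] -/
theorem orbit_coe_ofSymplectic_eq_image [Nonempty l] {d : symplecticGroup l K}
    (hcomm : ∀ (u : K) (hu : u ≠ 0), scalarBlockGSp u hu * ofSymplectic d = ofSymplectic d * scalarBlockGSp u hu) :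
    orbit (symplecticSimilitudeInt l K)
        ((ofSymplectic d : symplecticSimilitudeGroup l K) : symplecticSimilitudeGroup l K ⧸ symplecticSimilitudeInt l K) =
      symplecticCosetToSimilitude l K '' orbit (symplecticInt l K) (d : symplecticGroup l K ⧸ symplecticInt l K) := by
  ext γ
  constructor
  · rintro ⟨k', rfl⟩
    obtain ⟨S, hS, hk'⟩ := exists_eq_ofSymplectic_mul_scalarBlockGSp k'.2
    refine ⟨(⟨S, hS⟩ : symplecticInt l K) • (d : symplecticGroup l K ⧸ symplecticInt l K), mem_orbit _ _, ?_⟩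
    change symplecticCosetToSimilitude l K ((S : symplecticGroup l K) • (d : symplecticGroup l K ⧸ symplecticInt l K)) =
      (k' : symplecticSimilitudeGroup l K) • ((ofSymplectic d : symplecticSimilitudeGroup l K) :
        symplecticSimilitudeGroup l K ⧸ symplecticSimilitudeInt l K)
    rw [MulAction.Quotient.smul_coe, smul_eq_mul, symplecticCosetToSimilitude_coe, map_mul, MulAction.Quotient.smul_coe, smul_eq_mul,
      hk', mul_assoc, hcomm, ← mul_assoc, QuotientGroup.eq, _root_.mul_inv_rev, mul_assoc, mul_assoc, inv_mul_cancel_left,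
      inv_mul_cancel_left]
    exact scalarBlockGSp_mem_symplecticSimilitudeInt (v_multiplier_eq_one_of_mem_symplecticSimilitudeInt k'.2)
  · rintro ⟨η, ⟨k, rfl⟩, rfl⟩
    refine ⟨⟨ofSymplectic (k : symplecticGroup l K), ofSymplectic_mem_symplecticSimilitudeInt k.2⟩, ?_⟩
    change (ofSymplectic (k : symplecticGroup l K) : symplecticSimilitudeGroup l K) •
        ((ofSymplectic d : symplecticSimilitudeGroup l K) : symplecticSimilitudeGroup l K ⧸ symplecticSimilitudeInt l K) =
      symplecticCosetToSimilitude l K ((k : symplecticGroup l K) • (d : symplecticGroup l K ⧸ symplecticInt l K))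
    rw [symplecticCosetToSimilitude_smul, symplecticCosetToSimilitude_coe]

variable [IsHeckeTriple (⊤ : Submonoid (symplecticSimilitudeGroup l K)) (symplecticSimilitudeInt l K) (symplecticSimilitudeInt l K)]
  [IsHeckeTriple (⊤ : Submonoid (symplecticGroup l K)) (symplecticInt l K) (symplecticInt l K)]

/-- **`(𝟙_{GSp(𝒪) ι(d) GSp(𝒪)})♭ = 𝟙_{Sp(𝒪) d Sp(𝒪)}`.** [cite: AndrianovZhuravlev1995, Ch. 3 §3.3 Prop. 3.28] -/
theorem restrictToSymplectic_doubleCosetIndicator [Nonempty l] {d : symplecticGroup l K}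
    (hcomm : ∀ (u : K) (hu : u ≠ 0), scalarBlockGSp u hu * ofSymplectic d = ofSymplectic d * scalarBlockGSp u hu) :
    restrictToSymplectic (doubleCosetIndicator R (symplecticSimilitudeGroup l K) (symplecticSimilitudeInt l K)
        (ofSymplectic d)) =
      doubleCosetIndicator R (symplecticGroup l K) (symplecticInt l K) d := by
  classical
  refine MonoidAlgebra.ext (Finsupp.ext fun η => ?_)
  rw [coeff_restrictToSymplectic, heckeAlgebra.coeff_doubleCosetIndicator, heckeAlgebra.coeff_doubleCosetIndicator,
    orbit_coe_ofSymplectic_eq_image hcomm, symplecticCosetToSimilitude_injective.mem_set_image]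

/-- **`(T_{ι d})♭ = T_d`** for `d ∈ Sp(J, K)` commuting with the unit blocks. [cite: AndrianovZhuravlev1995, Ch. 3 §3.3 Prop. 3.28] -/
theorem restrictHeckeToSymplectic_doubleCosetOperator {n : ℕ} [NeZero n]
    [IsHeckeTriple (⊤ : Submonoid (symplecticSimilitudeGroup (Fin n) K)) (symplecticSimilitudeInt (Fin n) K)
      (symplecticSimilitudeInt (Fin n) K)]
    [IsHeckeTriple (⊤ : Submonoid (symplecticGroup (Fin n) K)) (symplecticInt (Fin n) K) (symplecticInt (Fin n) K)]
    {d : symplecticGroup (Fin n) K}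
    (hcomm : ∀ (u : K) (hu : u ≠ 0), scalarBlockGSp u hu * ofSymplectic d = ofSymplectic d * scalarBlockGSp u hu) :
    restrictHeckeToSymplectic (heckeAlgebra.doubleCosetOperator (k := R) (symplecticSimilitudeInt (Fin n) K) (ofSymplectic d)) =
      heckeAlgebra.doubleCosetOperator (k := R) (symplecticInt (Fin n) K) d := by
  haveI : Nonempty (Fin n) := ⟨⟨0, Nat.pos_of_ne_zero (NeZero.ne n)⟩⟩
  refine heckeAlgebra.toVector_injective (symplecticInt (Fin n) K) ?_
  rw [toVector_restrictHeckeToSymplectic, heckeAlgebra.toVector_doubleCosetOperator, heckeAlgebra.toVector_doubleCosetOperator,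
    restrictToSymplectic_doubleCosetIndicator hcomm]

/-- **`𝒮^{GSp}_q(T_{ι d}) = (·, 0)_* 𝒮^{Sp}_q(T_d)`** for `d ∈ Sp(J, K)` commuting with the unit blocks (`T_{ι d}[GSp(𝒪)]` lives on
multiplier-zero cosets, and restricts to `T_d[Sp(𝒪)]`). [cite: CartierCorvallis1979, §IV (4.2)] [cite: AndrianovZhuravlev1995, Ch. 3 §3.3 (3.49), Prop. 3.28] -/
theorem similitudeSatakeTransform_doubleCosetOperator_ofSymplectic {n : ℕ} [NeZero n]
    [IsHeckeTriple (⊤ : Submonoid (symplecticSimilitudeGroup (Fin n) K)) (symplecticSimilitudeInt (Fin n) K)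
      (symplecticSimilitudeInt (Fin n) K)]
    [IsHeckeTriple (⊤ : Submonoid (symplecticGroup (Fin n) K)) (symplecticInt (Fin n) K) (symplecticInt (Fin n) K)]
    (hϖ : Valued.v ϖ = WithZero.exp (-1 : ℤ)) (q : Rˣ) {d : symplecticGroup (Fin n) K}
    (hcomm : ∀ (u : K) (hu : u ≠ 0), scalarBlockGSp u hu * ofSymplectic d = ofSymplectic d * scalarBlockGSp u hu) :
    similitudeSatakeTransform hϖ q (heckeAlgebra.doubleCosetOperator (symplecticSimilitudeInt (Fin n) K) (ofSymplectic d)) =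
      AddMonoidAlgebra.mapDomain (AddMonoidHom.inl (Fin n → ℤ) ℤ)
        (symplecticSatakeTransform hϖ q (heckeAlgebra.doubleCosetOperator (symplecticInt (Fin n) K) d)) := by
  rw [similitudeSatakeTransform_eq_mapDomain_inl hϖ q (support_toVector_subset_range_of_snd_eq_zero hϖ fun γ hγ => by
      rw [snd_similitudeIwasawaExp_out_eq_of_mem_support_doubleCosetOperator hϖ _ hγ, similitudeIwasawaExp_ofSymplectic]),
    restrictHeckeToSymplectic_doubleCosetOperator hcomm]

/-- **The multiplier-zero Cartan operators of `GSp_{2n}` come from `Sp_{2n}`**: `t(0, a) = ι(diag(ϖ^a; ϖ^{-a}))` and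
`𝒮^{GSp}_q(T_{t(0,a)}) = (·, 0)_* 𝒮^{Sp}_q(T_{diag(ϖ^a; ϖ^{-a})})` — in particular `𝒮^{GSp}_q(T_{t(0,a)})` is invariant under the
signed permutations of `ℤⁿ` (the tree's `coeff_symplecticSatakeTransform_signedPerm`). [cite: AndrianovZhuravlev1995, Ch. 3 §3.3 Prop. 3.28, Thm. 3.30]
[cite: CartierCorvallis1979, §IV (4.2), Thm. 4.1 (b)] -/
theorem similitudeSatakeTransform_doubleCosetOperator_similitudeTorusElt_zero {n : ℕ} [NeZero n]
    [IsHeckeTriple (⊤ : Submonoid (symplecticSimilitudeGroup (Fin n) K)) (symplecticSimilitudeInt (Fin n) K)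
      (symplecticSimilitudeInt (Fin n) K)]
    [IsHeckeTriple (⊤ : Submonoid (symplecticGroup (Fin n) K)) (symplecticInt (Fin n) K) (symplecticInt (Fin n) K)]
    (hϖ : Valued.v ϖ = WithZero.exp (-1 : ℤ)) (q : Rˣ) (a : Fin n → ℤ) :
    similitudeSatakeTransform hϖ q (heckeAlgebra.doubleCosetOperator (symplecticSimilitudeInt (Fin n) K)
        (similitudeTorusElt (uniformizer_ne_zero hϖ) 0 a : symplecticSimilitudeGroup (Fin n) K)) =
      AddMonoidAlgebra.mapDomain (AddMonoidHom.inl (Fin n → ℤ) ℤ)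
        (symplecticSatakeTransform hϖ q (heckeAlgebra.doubleCosetOperator (symplecticInt (Fin n) K)
          (⟨Matrix.diagonal (Sum.elim (fun i => ϖ ^ a i) (fun i => ϖ ^ (-a i))),
            diagonal_mem_symplecticGroup fun i => by
              rw [Sum.elim_inl, Sum.elim_inr, ← zpow_add₀ (uniformizer_ne_zero hϖ), add_neg_cancel, zpow_zero]⟩ :
            symplecticGroup (Fin n) K))) := by
  have h1 : (similitudeTorusElt (uniformizer_ne_zero hϖ) 0 a : symplecticSimilitudeGroup (Fin n) K) =
      ofSymplectic ⟨Matrix.diagonal (Sum.elim (fun i => ϖ ^ a i) (fun i => ϖ ^ (-a i))),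
        diagonal_mem_symplecticGroup fun i => by
          rw [Sum.elim_inl, Sum.elim_inr, ← zpow_add₀ (uniformizer_ne_zero hϖ), add_neg_cancel, zpow_zero]⟩ := by
    change scalarBlockGSp (ϖ ^ (0 : ℤ)) _ * ofSymplectic _ = _
    have h0 : (scalarBlockGSp (ϖ ^ (0 : ℤ)) (zpow_ne_zero 0 (uniformizer_ne_zero hϖ)) : symplecticSimilitudeGroup (Fin n) K) = 1 := by
      convert scalarBlockGSp_one (K := K) (l := Fin n) using 2; exact zpow_zero ϖ
    rw [h0, one_mul]
  rw [h1]
  exact similitudeSatakeTransform_doubleCosetOperator_ofSymplectic hϖ q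
    (scalarBlockGSp_mul_ofSymplectic_comm_of_diagonal rfl)

end Diagonal

end Literature.NumberTheory.Automorphic.SymplecticCartan

end
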